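import Literature.NumberTheory.LFunctions.WeilExplicitProofs
import Literature.NumberTheory.LFunctions.WeilExplicitFormulaProofs
import Literature.NumberTheory.LFunctions.WeilSemilocalQuadratic
import HarnessLib

/-!
# Zeros-side floors: every finite set of zeta zeros bounds every window energy from below (under RH)

The theorem side of «lineage Z» (cc-s2-1 gen16, `HOME/cc-s2-1/gen16/NULLSPACE-Z.md`).

For a Weil test function `g` the Guinand–Weil explicit formula (tree: `explicit_formula_holds`) says
`Q(g) = W(g ⋆ g̃) = lim_{T → ∞} Σ_{|Im ρ| ≤ T} m(ρ) (g ⋆ g̃)^(ρ)`, and on the critical line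
`(g ⋆ g̃)^(ρ) = |ĝ(ρ)|²` (tree: `weilMellin_weilQuadratic_of_re_eq`).  Under the Riemann hypothesis
every summand is therefore the non-negative real number `m(ρ)|ĝ(ρ)|²`, the truncated zero sides are
MONOTONE in `T`, and a monotone sequence lies below its limit.  Hence

* `re_weilZeroSidePartial_le_re_weilQuadratic`:  `Σ_{|Im ρ| ≤ T} m(ρ)|ĝ(ρ)|² ≤ Re Q(g)` for EVERY `T`
  (the tree had only the `T → ∞` consequence `0 ≤ Re Q(g)`, `WeilPositivity.of_riemannHypothesis`);
* `sum_normSq_weilMellin_le_re_weilQuadratic`: the same for ANY finite set of zeros inside a box;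
* `re_weilZeroSidePartial_le_re_weilSemilocalQuadratic` / `sum_normSq_weilMellin_le_re_weilSemilocalQuadratic`:
  on the window `[-(log (N+1))/2, (log (N+1))/2]`, if every prime power `≤ N` is `S`-smooth, the
  SEMI-LOCAL form `Q_S(g)` (tree: `weilSemilocalQuadratic`) obeys the same floors, because there it IS
  Weil's form (tree: `weilSemilocalQuadratic_eq_weilQuadratic_of_forall`).

So, under RH, finitely many zeros give certified LOWER bounds for every semi-local window energy — the
inequality behind the zeros-side engine of `NULLSPACE-Z.md` (which reproduces the lineage-E deletion table
from `10⁵` certified zeros to `≤ 1.4e-5`, always from below).  Every statement here is CONDITIONAL on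
`RiemannHypothesis` (taken as a hypothesis `hRH`); nothing here bears on its truth.
-/

open Complex Filter Set MeasureTheory
open scoped Real Topology ComplexConjugate

set_option linter.dupNamespace false

namespace Summit.RiemannHypothesis.RiemannHypothesis.Theorems.SemilocalZerosSideFloor

open Literature.NumberTheory.LFunctions

variable {g : ℝ → ℂ}

/-- Under RH every index `ρ ∈ weilZeroIndex T` lies on the critical line, so the summand of the
truncated zero side of `g ⋆ g̃` at `ρ` is the real number `m(ρ)·|ĝ(ρ)|²`. -/
theorem summand_eq_normSq (hRH : RiemannHypothesis) (hg : IsWeilTest g) {T : ℝ} {ρ : ℂ}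
    (hρ : ρ ∈ weilZeroIndex T) :
    (riemannZetaZeroOrder ρ : ℂ) * weilMellin (weilConv g (weilReflect g)) ρ =
      (((riemannZetaZeroOrder ρ : ℝ) * Complex.normSq (weilMellin g ρ) : ℝ) : ℂ) := by
  obtain ⟨hζ, -, -, him, -⟩ := hρ
  have hne : ρ ≠ 1 := by
    rintro rfl
    simp at him
  have hre : ρ.re = 1 / 2 := by
    refine hRH ρ hζ ?_ hne
    rintro ⟨n, rfl⟩
    simp at him
  rw [weilMellin_weilQuadratic_of_re_eq hg hre]
  push_cast
  ring

/-- Under RH the summand is non-negative: `0 ≤ m(ρ)·|ĝ(ρ)|²` (`m(ρ) ≥ 0` for `ρ ≠ 1`). -/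
theorem summand_nonneg {ρ : ℂ} (hρ1 : ρ ≠ 1) (g : ℝ → ℂ) :
    0 ≤ (riemannZetaZeroOrder ρ : ℝ) * Complex.normSq (weilMellin g ρ) :=
  mul_nonneg (by exact_mod_cast riemannZetaZeroOrder_nonneg hρ1) (Complex.normSq_nonneg _)

/-- The index boxes increase with the height: `weilZeroIndex T ⊆ weilZeroIndex T'` for `T ≤ T'`. -/
theorem weilZeroIndex_mono {T T' : ℝ} (h : T ≤ T') : weilZeroIndex T ⊆ weilZeroIndex T' := by
  rintro ρ ⟨hζ, h0, h1, him, hT⟩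
  exact ⟨hζ, h0, h1, him, hT.trans h⟩

/-- Under RH the real part of the truncated zero side of `g ⋆ g̃` is the finite sum
`Σ_{ρ ∈ weilZeroIndex T} m(ρ)|ĝ(ρ)|²` of non-negative reals. -/
theorem re_weilZeroSidePartial_eq_sum (hRH : RiemannHypothesis) (hg : IsWeilTest g) (T : ℝ) :
    (weilZeroSidePartial (weilConv g (weilReflect g)) T).re =
      ∑ ρ ∈ (weilZeroIndex_finite T).toFinset,
        (riemannZetaZeroOrder ρ : ℝ) * Complex.normSq (weilMellin g ρ) := by
  unfold weilZeroSidePartial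
  rw [finsum_mem_eq_finite_toFinset_sum _ (weilZeroIndex_finite T), Complex.re_sum]
  refine Finset.sum_congr rfl fun ρ hρ ↦ ?_
  rw [summand_eq_normSq hRH hg ((weilZeroIndex_finite T).mem_toFinset.1 hρ), Complex.ofReal_re]

/-- Under RH the truncated zero sides of `g ⋆ g̃` are MONOTONE in the truncation height
(larger boxes, non-negative summands). -/
theorem re_weilZeroSidePartial_mono (hRH : RiemannHypothesis) (hg : IsWeilTest g) :
    Monotone fun T ↦ (weilZeroSidePartial (weilConv g (weilReflect g)) T).re := by
  intro T T' h
  simp only [re_weilZeroSidePartial_eq_sum hRH hg]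
  refine Finset.sum_le_sum_of_subset_of_nonneg ?_ fun ρ hρ _ ↦ ?_
  · intro ρ hρ
    exact (weilZeroIndex_finite T').mem_toFinset.2
      (weilZeroIndex_mono h ((weilZeroIndex_finite T).mem_toFinset.1 hρ))
  · obtain ⟨-, -, -, him, -⟩ := (weilZeroIndex_finite T').mem_toFinset.1 hρ
    exact summand_nonneg (by rintro rfl; simp at him) g

/-- **Zeros-side floor for Weil's quadratic form (under RH).** For every smooth compactly supported
`g` and every height `T`:  `Re Σ_{|Im ρ| ≤ T} m(ρ)(g ⋆ g̃)^(ρ) = Σ_{|Im ρ| ≤ T} m(ρ)|ĝ(ρ)|² ≤ Re Q(g)`.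
Proof: the truncated zero sides are monotone in `T` (`re_weilZeroSidePartial_mono`) and converge to
`Q(g)` by the explicit formula (`explicit_formula_holds`); a monotone function lies below its limit
(`Monotone.ge_of_tendsto`). The tree's `WeilPositivity.of_riemannHypothesis` is the `T → -∞`-free
shadow `0 ≤ Re Q(g)` of this inequality. -/
theorem re_weilZeroSidePartial_le_re_weilQuadratic (hRH : RiemannHypothesis) (hg : IsWeilTest g)
    (T : ℝ) :
    (weilZeroSidePartial (weilConv g (weilReflect g)) T).re ≤ (weilQuadratic g).re := by
  have hk : IsWeilTest (weilConv g (weilReflect g)) := hg.weilConv hg.weilReflect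
  have hlim : Tendsto (fun T ↦ (weilZeroSidePartial (weilConv g (weilReflect g)) T).re) atTop
      (𝓝 (weilQuadratic g).re) :=
    (Complex.continuous_re.tendsto _).comp (explicit_formula_holds hk)
  exact (re_weilZeroSidePartial_mono hRH hg).ge_of_tendsto hlim T

/-- The same floor written as a sum of squared moduli over the box of zeros:
`Σ_{ρ ∈ weilZeroIndex T} m(ρ)|ĝ(ρ)|² ≤ Re Q(g)`. -/
theorem sum_box_normSq_weilMellin_le_re_weilQuadratic (hRH : RiemannHypothesis) (hg : IsWeilTest g)
    (T : ℝ) :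
    ∑ ρ ∈ (weilZeroIndex_finite T).toFinset,
        (riemannZetaZeroOrder ρ : ℝ) * Complex.normSq (weilMellin g ρ) ≤ (weilQuadratic g).re := by
  rw [← re_weilZeroSidePartial_eq_sum hRH hg T]
  exact re_weilZeroSidePartial_le_re_weilQuadratic hRH hg T

/-- **Any finite set of zeros bounds `Q(g)` from below (under RH).** If `F` is a finite set of
non-trivial zeros inside some box `weilZeroIndex T` (e.g. the first `J` zeros and their conjugates),
then `Σ_{ρ ∈ F} m(ρ)|ĝ(ρ)|² ≤ Re Q(g)`: dropping non-negative terms. This is the inequality behind the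
zeros-side engine «lineage Z»: its truncated Gram matrices are `≤` Weil's window form. -/
theorem sum_normSq_weilMellin_le_re_weilQuadratic (hRH : RiemannHypothesis) (hg : IsWeilTest g)
    {T : ℝ} {F : Finset ℂ} (hF : ↑F ⊆ weilZeroIndex T) :
    ∑ ρ ∈ F, (riemannZetaZeroOrder ρ : ℝ) * Complex.normSq (weilMellin g ρ) ≤ (weilQuadratic g).re := by
  refine le_trans ?_ (sum_box_normSq_weilMellin_le_re_weilQuadratic hRH hg T)
  refine Finset.sum_le_sum_of_subset_of_nonneg (fun ρ hρ ↦ ?_) fun ρ hρ _ ↦ ?_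
  · exact (weilZeroIndex_finite T).mem_toFinset.2 (hF hρ)
  · obtain ⟨-, -, -, him, -⟩ := (weilZeroIndex_finite T).mem_toFinset.1 hρ
    exact summand_nonneg (by rintro rfl; simp at him) g

/-- **Zeros-side floor for the SEMI-LOCAL form on a window (under RH).** If every prime power `n ≤ N`
is `S`-smooth and `g` is supported in `[-(log (N+1))/2, (log (N+1))/2]`, then for every height `T`
`Σ_{|Im ρ| ≤ T} m(ρ)|ĝ(ρ)|² ≤ Re Q_S(g)` — on that window the semi-local form is Weil's form
(`weilSemilocalQuadratic_eq_weilQuadratic_of_forall`). With `S = U(b)` = all primes `≤ e^{2b}` and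
`N = ⌊e^{2b}⌋` this is the window form of the prime-deletion line. -/
theorem re_weilZeroSidePartial_le_re_weilSemilocalQuadratic (hRH : RiemannHypothesis)
    (hg : IsWeilTest g) {S : Finset ℕ} {N : ℕ} (hS : ∀ n ≤ N, IsPrimePow n → n.primeFactors ⊆ S)
    (hsupp : tsupport g ⊆ Icc (-(Real.log ((N : ℝ) + 1) / 2)) (Real.log ((N : ℝ) + 1) / 2)) (T : ℝ) :
    (weilZeroSidePartial (weilConv g (weilReflect g)) T).re ≤ (weilSemilocalQuadratic S g).re := by
  rw [weilSemilocalQuadratic_eq_weilQuadratic_of_forall hg hS hsupp]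
  exact re_weilZeroSidePartial_le_re_weilQuadratic hRH hg T

/-- **Any finite set of zeros bounds the semi-local window energy from below (under RH)**:
`Σ_{ρ ∈ F} m(ρ)|ĝ(ρ)|² ≤ Re Q_S(g)` for `F ⊆ weilZeroIndex T`, `g` on the window, prime powers `≤ N`
`S`-smooth. Consequently every Rayleigh quotient of `Re Q_S` on the window — in particular every section
bottom certified by the prime-side engines — is at least the corresponding quotient of the finitely
truncated zeros-side form. -/
theorem sum_normSq_weilMellin_le_re_weilSemilocalQuadratic (hRH : RiemannHypothesis)
    (hg : IsWeilTest g) {S : Finset ℕ} {N : ℕ} (hS : ∀ n ≤ N, IsPrimePow n → n.primeFactors ⊆ S)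
    (hsupp : tsupport g ⊆ Icc (-(Real.log ((N : ℝ) + 1) / 2)) (Real.log ((N : ℝ) + 1) / 2))
    {T : ℝ} {F : Finset ℂ} (hF : ↑F ⊆ weilZeroIndex T) :
    ∑ ρ ∈ F, (riemannZetaZeroOrder ρ : ℝ) * Complex.normSq (weilMellin g ρ) ≤
      (weilSemilocalQuadratic S g).re := by
  rw [weilSemilocalQuadratic_eq_weilQuadratic_of_forall hg hS hsupp]
  exact sum_normSq_weilMellin_le_re_weilQuadratic hRH hg hF

/-- **Monotone convergence from below.** Under RH the floors increase with `T` and converge to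
`Re Q_S(g)`: the zeros-side truncations EXHAUST the window energy (explicit formula), which is why the
lineage-Z bottoms rise monotonically to the lineage-E bottoms as zeros are added. -/
theorem tendsto_re_weilZeroSidePartial_weilSemilocalQuadratic (hg : IsWeilTest g) {S : Finset ℕ} {N : ℕ}
    (hS : ∀ n ≤ N, IsPrimePow n → n.primeFactors ⊆ S)
    (hsupp : tsupport g ⊆ Icc (-(Real.log ((N : ℝ) + 1) / 2)) (Real.log ((N : ℝ) + 1) / 2)) :
    Tendsto (fun T ↦ (weilZeroSidePartial (weilConv g (weilReflect g)) T).re) atTop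
      (𝓝 (weilSemilocalQuadratic S g).re) := by
  rw [weilSemilocalQuadratic_eq_weilQuadratic_of_forall hg hS hsupp]
  exact (Complex.continuous_re.tendsto _).comp (explicit_formula_holds (hg.weilConv hg.weilReflect))

end Summit.RiemannHypothesis.RiemannHypothesis.Theorems.SemilocalZerosSideFloor
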